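import Summits.AtomisticToContinuum.Crystallization.Theses.IsometryAtoms
import Literature.MathematicalPhysics.StatisticalMechanics.BarlowStacking
import Summits.AtomisticToContinuum.Crystallization.Theorems.PalmUnimodularRigidityMinimiserShellsMeckePricing

/-!
# Sketch (crux-ideate, ideator 1, round 1) — crux `IsometryAtoms.MinimisingLawsHaveAtoms`
# (stmt-AtomisticToContinuum-15776)

Idea `strict-calibration-exactness`: EXACT COMPLEMENTARY SLACKNESS in the Palm LP.
A STRICT Mecke calibration (bounded finite-hop bond transfer `t`, slack
`σ := h + div t − e* ≥ 0` on every hard-core rooted configuration, `σ = 0` only on configurations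
whose `R₀`-ball is EXACTLY that of a rooted copy of the template `Y`) makes every minimising
point-stationary law almost surely exact at radius `R₀` (`FirstLemma`, a corollary of the landed
Mecke pricing `PalmUnimodularRigidityMinimiserShells.MeckePricing.stub_meckePricing_unfolded` with
the events `G_η := {h + div t < e* + η}`, `η = 1/n`); the exact local theorem in law form
(`SecondLemma`) turns "exact at every site" into "a rooted copy of `Y`", i.e. the law charges the
rooted isometry class of `Y` with full mass: PURITY with `Y` an exact relaxed hcp crystal.
No robust chart (9227) and no elastic tube (9226) is used: exactness is delivered by slackness.
-/

noncomputable section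

open MeasureTheory
open Literature.Probability.Process (IsPointStationaryLaw IsRootedHardCore)
open Literature.MathematicalPhysics.StatisticalMechanics (lennardJones rootEnergy PeriodicConfiguration
  hcpStacking)

namespace Summit.AtomisticToContinuum.Crystallization.Cruxes.MinimisingLawsHaveAtoms.IdeatorOne

/-- Euclidean 3-space. -/
abbrev E3 := EuclideanSpace ℝ (Fin 3)

/-- `e* = ⨅` over periodic configurations of the LJ energy per particle (genuine infimum:
`crysPeriodicBddBelow_proof`). -/
def eStar : ℝ := ⨅ Q : PeriodicConfiguration 3, Q.energyPerParticle lennardJones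

/-- Divergence at the root of a bond transfer `t` ("sent minus received"), the Mecke-exact part of a
calibration: `E_P[divT t] = 0` for every point-stationary hard-core law (landed:
`MeckePricing.transfer_package`). -/
def divT (t : Measure E3 → E3 → ℝ) (μ : Measure E3) : ℝ :=
  ∫ y, (t μ y - t (Measure.map (fun z => z - y) μ) (-y)) ∂μ

/-- The rooted isometry class of a template `Y` — literally the event of the crux. -/
def rootedClass (Y : Set E3) : Set (Measure E3) :=
  {μ | ∃ A : E3 →ₗᵢ[ℝ] E3, ∃ q ∈ Y,
    μ = (Measure.count : Measure E3).restrict ((fun s => A (s - q)) '' Y)}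

/-- EXACT environment of radius `R₀`: the root's closed `R₀`-ball coincides with that of a rooted
isometric copy of `Y` (no tolerance). -/
def ExactEnvAt (R₀ : ℝ) (Y : Set E3) (μ : Measure E3) : Prop :=
  ∃ ν ∈ rootedClass Y,
    μ.restrict (Metric.closedBall (0 : E3) R₀) = ν.restrict (Metric.closedBall (0 : E3) R₀)

/-- **Strict Mecke calibration** at template `Y`, hard core `δ`, exactness radius `R₀`: a jointly
measurable, bounded, finite-hop bond transfer `t` (the landed pricing hypotheses verbatim) such that
(i) `e* ≤ h + div t` on EVERY rooted `δ`-hard-core configuration (slack `σ ≥ 0`; weak duality) and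
(ii) STRICTNESS: `σ = 0` forces the exact `Y`-environment of radius `R₀`.
`t μ y` may depend on all of `μ` (multi-hop routing of the `r⁻⁶` tail); only the hop length is `≤ R`. -/
def StrictCalibration (δ R₀ : ℝ) (Y : Set E3) : Prop :=
  ∃ (R M : ℝ) (t : Measure E3 → E3 → ℝ), Measurable (Function.uncurry t) ∧ (∀ μ y, |t μ y| ≤ M) ∧
    (∀ μ y, R < ‖y‖ → t μ y = 0) ∧
    (∀ μ : Measure E3, IsRootedHardCore δ μ → eStar ≤ rootEnergy lennardJones μ + divT t μ) ∧
    (∀ μ : Measure E3, IsRootedHardCore δ μ →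
      rootEnergy lennardJones μ + divT t μ = eStar → ExactEnvAt R₀ Y μ)

/-- **First lemma** (soft; the first checkable statement of the line): a strict calibration makes
every minimising point-stationary `δ`-hard-core probability law almost surely exact at radius `R₀`.
Proof route: landed `stub_meckePricing_unfolded` with `e₀ := e*`, `c₀ := 1/(n+1)`,
`G μ := h μ + div t μ < e* + 1/(n+1)` gives `P*(¬ G) = 0` for every `n`; with (i), a.s.
`h + div t = e*`; with (ii), a.s. exact. -/
def FirstLemma : Prop :=
  ∀ δ R₀ : ℝ, 0 < δ → ∀ Y : Set E3, StrictCalibration δ R₀ Y →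
    ∀ P : Measure (Measure E3), IsProbabilityMeasure P → (∀ᵐ μ ∂P, IsRootedHardCore δ μ) →
      IsPointStationaryLaw P → (∫ μ, rootEnergy lennardJones μ ∂P) ≤ eStar →
      ∀ᵐ μ ∂P, ExactEnvAt R₀ Y μ

/-- **The first lemma HOLDS** — it is a corollary of the landed Mecke pricing theorem
`PalmUnimodularRigidityMinimiserShells.MeckePricing.stub_meckePricing_unfolded` (9225 evidence), priced with the
events `G_n := {h + div t < e* + 1/(n+1)}`: each has `P*(¬ G_n) = 0`, so a.s. `h + div t ≤ e*`; weak duality gives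
equality, strictness gives the exact environment. -/
theorem firstLemma_holds : FirstLemma := by
  intro δ R₀ hδ Y hcal P hP hhc hst hE
  obtain ⟨R, M, t, ht, hM, hR, hweak, hstrict⟩ := hcal
  have hmean : Summit.AtomisticToContinuum.Crystallization.Theorems.MinimiserShells.Negative.LoadBearing.meanRootEnergy
      P ≤ eStar := hE
  have key : ∀ n : ℕ, ∀ᵐ μ ∂P, rootEnergy lennardJones μ + divT t μ < eStar + 1 / ((n : ℝ) + 1) := by
    intro n
    have hc₀ : (0 : ℝ) ≤ 1 / ((n : ℝ) + 1) := by positivity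
    have hpos : (0 : ℝ) < 1 / ((n : ℝ) + 1) := by positivity
    have hpr :=
      Summit.AtomisticToContinuum.Crystallization.Theorems.PalmUnimodularRigidityMinimiserShells.MeckePricing.stub_meckePricing_unfolded
        δ hδ P hP hhc hst R M t ⟨ht, hM, hR⟩
        (fun μ => rootEnergy lennardJones μ + divT t μ < eStar + 1 / ((n : ℝ) + 1)) eStar (1 / ((n : ℝ) + 1)) hc₀
        (fun μ hμ => ⟨hweak μ hμ, fun hG => not_lt.1 hG⟩)
    have hprod : 1 / ((n : ℝ) + 1) *
        (P {μ | ¬ (rootEnergy lennardJones μ + divT t μ < eStar + 1 / ((n : ℝ) + 1))}).toReal ≤ 0 := by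
      linarith
    have hnn : 0 ≤ (P {μ | ¬ (rootEnergy lennardJones μ + divT t μ < eStar + 1 / ((n : ℝ) + 1))}).toReal :=
      ENNReal.toReal_nonneg
    have hzero : (P {μ | ¬ (rootEnergy lennardJones μ + divT t μ < eStar + 1 / ((n : ℝ) + 1))}).toReal = 0 :=
      le_antisymm (by nlinarith [mul_nonneg hpos.le hnn]) hnn
    have hnull : P {μ | ¬ (rootEnergy lennardJones μ + divT t μ < eStar + 1 / ((n : ℝ) + 1))} = 0 := by
      rcases (ENNReal.toReal_eq_zero_iff _).1 hzero with h0 | htop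
      · exact h0
      · exact absurd htop (measure_ne_top P _)
    rw [ae_iff]
    exact hnull
  have hall : ∀ᵐ μ ∂P, ∀ n : ℕ, rootEnergy lennardJones μ + divT t μ < eStar + 1 / ((n : ℝ) + 1) :=
    ae_all_iff.2 key
  filter_upwards [hall, hhc] with μ hμ hμhc
  have hle : rootEnergy lennardJones μ + divT t μ ≤ eStar := by
    refine le_of_forall_pos_lt_add fun ε hε => ?_
    obtain ⟨n, hn⟩ := exists_nat_one_div_lt hε
    calc rootEnergy lennardJones μ + divT t μ < eStar + 1 / ((n : ℝ) + 1) := hμ n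
      _ < eStar + ε := by linarith
  exact hstrict μ hμhc (le_antisymm hle (hweak μ hμhc))

/-- **Exact local theorem** (deterministic, potential-free): a point set containing `0` all of
whose points have exact `Y`-environments of radius `R₀` IS a rooted isometric copy of `Y`. For
`Y` = relaxed hcp and `R₀ = 2a` this is finite rigid geometry (non-ideal `c/a` splits the first
shell `6 + 6`, which only helps). -/
def LocallyRigid (R₀ : ℝ) (Y : Set E3) : Prop :=
  ∀ S : Set E3, (0 : E3) ∈ S →
    (∀ x ∈ S, ExactEnvAt R₀ Y ((Measure.count : Measure E3).restrict ((fun s => s - x) '' S))) →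
    (Measure.count : Measure E3).restrict S ∈ rootedClass Y

/-- **Second lemma** (law form of the exact local theorem): "root a.s. exact ⇒ every point a.s.
exact" (mass transport with `g(μ,y) = 1[environment at y not exact]`, the landed
`cruxesToPalmRigidity` device) and `LocallyRigid` give: a.s. the configuration is a rooted copy of
`Y`. -/
def SecondLemma : Prop :=
  ∀ δ R₀ : ℝ, 0 < δ → ∀ Y : Set E3, LocallyRigid R₀ Y →
    ∀ P : Measure (Measure E3), IsProbabilityMeasure P → (∀ᵐ μ ∂P, IsRootedHardCore δ μ) →
      IsPointStationaryLaw P → (∀ᵐ μ ∂P, ExactEnvAt R₀ Y μ) → ∀ᵐ μ ∂P, μ ∈ rootedClass Y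

/-- **The line concludes the crux BY NAME.** Strict calibration at a relaxed hcp template (for each
hard core `δ`) + local rigidity of that template + the second soft lemma (the first is PROVED above) ⇒ PURITY: the minimising law
charges the rooted isometry class of `hcpStacking a h` with mass one. (Kernel-checked composition;
the content is in the hypotheses.) -/
theorem minimisingLawsHaveAtoms_of (h2 : SecondLemma)
    (hcal : ∀ δ : ℝ, 0 < δ → ∃ a h R₀ : ℝ,
      StrictCalibration δ R₀ (hcpStacking a h) ∧ LocallyRigid R₀ (hcpStacking a h)) :
    Summit.AtomisticToContinuum.Crystallization.Theses.IsometryAtoms.MinimisingLawsHaveAtoms := by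
  intro δ hδ P hP hhc hst hE
  obtain ⟨a, h, R₀, hc, hr⟩ := hcal δ hδ
  refine ⟨hcpStacking a h, ?_⟩
  have hae : ∀ᵐ μ ∂P, μ ∈ rootedClass (hcpStacking a h) :=
    h2 δ R₀ hδ _ hr P hP hhc hst (firstLemma_holds δ R₀ hδ _ hc P hP hhc hst hE)
  change 0 < P (rootedClass (hcpStacking a h))
  have h0 : P (rootedClass (hcpStacking a h))ᶜ = 0 := by
    rw [ae_iff] at hae
    simpa [Set.compl_def] using hae
  have h1' : (1 : ENNReal) ≤ P (rootedClass (hcpStacking a h)) := by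
    calc (1 : ENNReal) = P Set.univ := measure_univ.symm
      _ = P (rootedClass (hcpStacking a h) ∪ (rootedClass (hcpStacking a h))ᶜ) := by
          rw [Set.union_compl_self]
      _ ≤ P (rootedClass (hcpStacking a h)) + P (rootedClass (hcpStacking a h))ᶜ :=
          measure_union_le _ _
      _ = P (rootedClass (hcpStacking a h)) := by rw [h0, add_zero]
  exact lt_of_lt_of_le one_pos h1'

end Summit.AtomisticToContinuum.Crystallization.Cruxes.MinimisingLawsHaveAtoms.IdeatorOne

end
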